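import Summits.CriticalPhenomena.PercolationContinuityZ3.Theorems.PercNearOneGluingNoHeavyConstsCrossExchange
import Summits.CriticalPhenomena.PercolationContinuityZ3.Theorems.PercNearOneGluingNoHeavyConstsCrossReach
import HarnessLib

/-!
# CROSS at the reach marker, on-reach class, unconditionally (PAPER-2 track (ii), seat `prim-consts-2`, gen 20; landed by gen 21)

builds on p205010 (kernel theorem, internal audit signed; external expert review pending).  Support file (`--supports
stmt-CriticalPhenomena-4575`); one theorem, no sorries, standard axioms.  Both imports are in the tree (p367568 `…ConstsCrossExchange.lean`, p370513 `…ConstsCrossReach.lean`).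
* `Consts.crossRel_reach_of_eq_on_reach'` — `Consts.crossRel_reach_of_eq_on_reach` with (F1) discharged by `Consts.crossExchange_F1`.
[cite: VandenbergHaggstromKahn2005, Thm. 1.1 (pp. 3–5), Thm. 1.3 (p. 6)]
-/

noncomputable section

namespace Summit.CriticalPhenomena.PercolationContinuityZ3.Theorems

open MeasureTheory Set Literature.Probability.LatticeModels Literature.Probability.Percolation
open scoped Classical

namespace Consts

/-- **CROSS at `u = z`, reach-pinned class II, unconditionally**: `Consts.crossRel_reach_of_eq_on_reach` with its hypothesis (F1) discharged by
`Consts.crossExchange_F1`.  For monotone `F` constant on `{z ∈ V(C_s)}` (value `M`), both CROSS members for `X ⊂ X ∪ {z}` are `≥ 0`.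
[cite: VandenbergHaggstromKahn2005, Thm. 1.1 (pp. 3–5), Thm. 1.3 (p. 6)] -/
theorem crossRel_reach_of_eq_on_reach' {V : Type} [DecidableEq V] [Fintype V] (w : Sym2 V → unitInterval) (s y z : V) (X : Set V)
    (F : Set (Sym2 V) → ℝ) (hF : Monotone F) (M : ℝ) (hFz : ∀ C : Set (Sym2 V), (z = s ∨ ∃ e ∈ C, z ∈ e) → F C = M) :
    0 ≤ polMargin (prodBernoulli w) s y z F (insert z X) X X + polMargin (prodBernoulli w) s y z F X (insert z X) X +
        polMargin (prodBernoulli w) s y z F X X (insert z X) ∧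
      0 ≤ polMargin (prodBernoulli w) s y z F (insert z X) (insert z X) X +
          polMargin (prodBernoulli w) s y z F (insert z X) X (insert z X) +
        polMargin (prodBernoulli w) s y z F X (insert z X) (insert z X) := by
  refine crossRel_reach_of_eq_on_reach w s y z X F hF M hFz ?_
  have h := crossExchange_F1 w s y z X
  have e1 : {ω : BondConfig V | (openGraph ω).Reachable y z ∧ ¬ (openGraph ω).Reachable y s ∧
        (∀ x ∈ X, ¬ (openGraph ω).Reachable y x) ∧ (∀ x ∈ X, ¬ (openGraph ω).Reachable s x)} =
      {ω : BondConfig V | ∀ x ∈ insert s X, ¬ (openGraph ω).Reachable y x} ∩ {ω | ∀ x ∈ X, ¬ (openGraph ω).Reachable s x} ∩ openConn y z := by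
    ext ω; simp only [mem_setOf_eq, mem_inter_iff, forall_mem_insert, openConn]; tauto
  have e2 : {ω : BondConfig V | (openGraph ω).Reachable s y ∧ ¬ (openGraph ω).Reachable s z ∧ (∀ x ∈ X, ¬ (openGraph ω).Reachable s x)} =
      {ω : BondConfig V | ∀ x ∈ insert z X, ¬ (openGraph ω).Reachable s x} ∩ openConn s y := by
    ext ω; simp only [mem_setOf_eq, mem_inter_iff, forall_mem_insert, openConn]; tauto
  have e3 : {ω : BondConfig V | ¬ (openGraph ω).Reachable y s ∧ ¬ (openGraph ω).Reachable y z ∧ ¬ (openGraph ω).Reachable s z ∧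
        (∀ x ∈ X, ¬ (openGraph ω).Reachable y x) ∧ (∀ x ∈ X, ¬ (openGraph ω).Reachable s x)} =
      {ω : BondConfig V | ∀ x ∈ insert s (insert z X), ¬ (openGraph ω).Reachable y x} ∩ {ω | ∀ x ∈ insert z X, ¬ (openGraph ω).Reachable s x} := by
    ext ω; simp only [mem_setOf_eq, mem_inter_iff, forall_mem_insert]; tauto
  have e4 : {ω : BondConfig V | (openGraph ω).Reachable s z ∧ (∀ x ∈ X, ¬ (openGraph ω).Reachable s x)} =
      {ω : BondConfig V | ∀ x ∈ X, ¬ (openGraph ω).Reachable s x} ∩ openConn s z := by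
    ext ω; simp only [mem_setOf_eq, mem_inter_iff, openConn]; tauto
  rw [e1, e2, e3, e4] at h
  exact h

end Consts

end Summit.CriticalPhenomena.PercolationContinuityZ3.Theorems

end
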